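import Mathlib
import Literature.Computability.AlgebraicComplexity.NestFreeMatchingPoly
import Summits.ValiantsHypothesis.ValiantsHypothesis.Theorems.FifoMatchingGridCorShadowFaceLift
import Summits.ValiantsHypothesis.ValiantsHypothesis.Theorems.FifoMatchingNFPolytopeQueueGridFaceDefs
import HarnessLib

/-!
# T2 — the coordinate-face lift: A1 (the 0/1 points of the queue-grid face) carries shadows of the pair-pattern
# polytope `PP_r` up to shadows of `NFP_n = Newt(NN_n)` — Theorems-side port, def-free

Port to `Theorems/` (director-valiant g12 R180 (b)(i) / R193 (b), val-lit desk #270 (c): val-port-2 lineage = S-port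
hand, file F6) of § T2 of val-idea-7 g7's kernel-checked line workfile
`Cruxes/NNLinearDegreeCofactorHard/Lines/shadow_division.lean` rev 7 (`faceLift_threshold`, `suppPts_coord_dichotomy`,
`sumCoord_face`, `faceLift`; crit-3 VERDICT #21/#21b PASS-WITH-PRICE), verbatim bodies, with NO definitions (crit-3 #21b
port note (a)): the line's input A1 `QueueGridZeroOnePoints` is an explicit HYPOTHESIS BINDER (its text, over c1's
canonical `QueueGridFace` vocabulary `suppPts` / `QGV` / `patternVec`, p613693), and the σ-currency statements
`PPShadowHard` / `NFPShadowHard` / `shadowVerts` / `T` are UNFOLDED, so that the line file takes the theorem as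
`faceLift hA hP := GridCorShadow.faceLift hA hP` by plain definitional unfolding.

* `faceLift_threshold` — exponent bookkeeping `log₂ n ≤ 2 log₂ r + 7 ⇒ (log₂ n + c)^c + 2 ≤ (log₂ r + (3c+8))^(3c+8)`.
* `suppPts_coord_dichotomy` — integrality: the coordinates of a support point `realOf d` lie in `{0} ∪ [1, ∞)`.
* `sumCoord_face` — the coordinate-face functional `ψ_Z x = Σ_{e ∈ Z} x_e` on such a point set takes values in
  `{0} ∪ [1, ∞)`, and `S ∩ {ψ_Z = 0}` is the coordinate face `S ∩ {x_e = 0, e ∈ Z}`.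
* ★ `faceLift` — **T2**: A1 (for `r ≥ 1`, `n ≥ (r+1)(2r+1)`, the support points of `NN_n` vanishing on a coordinate set
  `Z`, read through an arc map `f`, are EXACTLY `range (patternVec r)`) and PP shadow hardness (for every `c`, eventually
  in `r`, some planar shadow of `range (patternVec r)` has `> 2^((log₂ r + c)^c)` hull vertices) give NFP shadow
  hardness (for every `c`, eventually in `n`, some planar shadow of `suppPts NN_n` has `> 2^((log₂ n + c)^c)` hull
  vertices): with `r + 1 = ⌊⌊√n⌋/2⌋` (so `(r+1)(2r+1) ≤ n` and `log₂ n ≤ 2 log₂ r + 5`), a PP shadow with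
  `> 2^((log₂ r + 3c+8)^(3c+8)) ≥ 4·2^((log₂ n + c)^c)` vertices has a pencil uniquely maximised at `> 2^((log₂ n + c)^c)`
  points, and the landed face lift `GridCorShadow.shadow_faceLift_count` (HY21 Lemma 10 in point form, F1 p620122)
  along A1's located coordinate face realises them all as vertices of a shadow of `suppPts NN_n`.

HONEST FRAMING: a CONDITIONAL transfer inside an OPEN line — both hypotheses are OPEN (A1 is the K1 gadget
combinatorics, kernel only in qg1 currency p617795, glue pending; PP shadow hardness follows in the line from G♭ =
stmt-27045 OPEN via the landed `GridCorShadow.gridCorShadowHard_of_cliqueFace` + `GridCorShadow.ppShadow_of_grid`);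
no rung of record moves; nothing here bears on `VP ≠ VNP`, which is NOT proved.

Source: P. Hrubeš, A. Yehudayoff, *Shadows of Newton polytopes*, CCC 2021 (LIPIcs 200:9) = Israel J. Math. 256 (2023)
[HrubesYehudayoff2021: Lemma 10 p.7, Prop 23 pp.10–11, Prop 43(2)/Rem 20 p.17].
-/

set_option autoImplicit false

-- the mandated summit-side namespace repeats a component by design (single-problem summit)
set_option linter.dupNamespace false

noncomputable section

namespace Summit.ValiantsHypothesis.ValiantsHypothesis.Theorems.FifoMatching

namespace GridCorShadow

open scoped NNReal
open MvPolynomial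
open Literature.Computability.AlgebraicComplexity
open Summit.ValiantsHypothesis.ValiantsHypothesis.Theorems.FifoMatching.QueueGridFace
  (realOf suppPts QGV patternVec)

/-- exponent bookkeeping for the face lift: `a ≤ 2 b + 7 ⇒ (a + c)^c + 2 ≤ (b + (3c+8))^(3c+8)`
(used with `a = log₂ n`, `b = log₂ r`). -/
theorem faceLift_threshold (c a b : ℕ) (h : a ≤ 2 * b + 7) :
    (a + c) ^ c + 2 ≤ (b + (3 * c + 8)) ^ (3 * c + 8) := by
  set y := b + c + 7 with hy
  have hy2 : 2 ≤ y := by omega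
  have h1 : (a + c) ^ c ≤ y ^ c * y ^ c := by
    calc (a + c) ^ c ≤ (2 * y) ^ c := Nat.pow_le_pow_left (by omega) c
      _ = 2 ^ c * y ^ c := Nat.mul_pow 2 y c
      _ ≤ y ^ c * y ^ c := Nat.mul_le_mul_right _ (Nat.pow_le_pow_left hy2 c)
  have hP : 1 ≤ y ^ c * y ^ c := Nat.one_le_iff_ne_zero.2 (by positivity)
  have h2 : y ^ c * y ^ c + 2 ≤ y ^ (2 * c + 2) := by
    have : y ^ (2 * c + 2) = y ^ c * y ^ c * (y * y) := by ring
    rw [this]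
    generalize hPdef : y ^ c * y ^ c = P at *
    have hyy : 4 ≤ y * y := Nat.mul_le_mul hy2 hy2
    have h4 : P * 4 ≤ P * (y * y) := Nat.mul_le_mul_left P hyy
    omega
  have h3 : y ^ (2 * c + 2) ≤ (b + (3 * c + 8)) ^ (2 * c + 2) := Nat.pow_le_pow_left (by omega) _
  have h4 : (b + (3 * c + 8)) ^ (2 * c + 2) ≤ (b + (3 * c + 8)) ^ (3 * c + 8) :=
    Nat.pow_le_pow_right (by omega) (by omega)
  omega

/-- integrality of support points: the coordinates of `realOf d`, `d ∈ supp g`, lie in `{0} ∪ [1, ∞)`. -/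
theorem suppPts_coord_dichotomy {σ : Type} (g : MvPolynomial σ ℝ≥0) :
    ∀ x ∈ suppPts g, ∀ i, x i = 0 ∨ 1 ≤ x i := by
  rintro x ⟨d, _, rfl⟩ i
  rcases Nat.eq_zero_or_pos (d i) with h | h
  · left; simp [realOf, h]
  · right
    show (1 : ℝ) ≤ ((d i : ℕ) : ℝ)
    exact_mod_cast h

/-- the coordinate-face functional `ψ_Z x = Σ_{e∈Z} x_e` on a point set with coordinates in `{0} ∪ [1,∞)`:
`ψ_Z ∈ {0} ∪ [1,∞)` on `S`, and `S ∩ {ψ_Z = 0}` is the coordinate face `S ∩ {x_e = 0, e ∈ Z}`. -/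
theorem sumCoord_face {α : Type} [Fintype α] [DecidableEq α] (S : Set (α → ℝ))
    (hint : ∀ x ∈ S, ∀ i, x i = 0 ∨ 1 ≤ x i) (Z : Finset α) :
    (∀ x ∈ S, (∑ a ∈ Z, LinearMap.proj a : (α → ℝ) →ₗ[ℝ] ℝ) x = 0 ∨
        1 ≤ (∑ a ∈ Z, LinearMap.proj a : (α → ℝ) →ₗ[ℝ] ℝ) x) ∧
      S ∩ {x | (∑ a ∈ Z, LinearMap.proj a : (α → ℝ) →ₗ[ℝ] ℝ) x = 0} = S ∩ {x | ∀ e ∈ Z, x e = 0} := by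
  have hψ : ∀ x : α → ℝ, (∑ a ∈ Z, LinearMap.proj a : (α → ℝ) →ₗ[ℝ] ℝ) x = ∑ a ∈ Z, x a := fun x => by
    simp [LinearMap.sum_apply]
  have hnn : ∀ x ∈ S, ∀ i, 0 ≤ x i := fun x hx i => by
    rcases hint x hx i with h | h
    · rw [h]
    · linarith
  have hzero : ∀ x ∈ S, ((∑ a ∈ Z, LinearMap.proj a : (α → ℝ) →ₗ[ℝ] ℝ) x = 0 ↔ ∀ e ∈ Z, x e = 0) := by
    intro x hx
    rw [hψ]
    exact Finset.sum_eq_zero_iff_of_nonneg fun e _ => hnn x hx e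
  refine ⟨fun x hx => ?_, ?_⟩
  · by_cases hall : ∀ e ∈ Z, x e = 0
    · exact Or.inl ((hzero x hx).2 hall)
    · right
      push Not at hall
      obtain ⟨a, haZ, hxa⟩ := hall
      have h1 : 1 ≤ x a := by
        rcases hint x hx a with h | h
        · exact absurd h hxa
        · exact h
      rw [hψ]
      exact le_trans h1 (Finset.single_le_sum (fun b _ => hnn x hx b) haZ)
  · ext x
    simp only [Set.mem_inter_iff, Set.mem_setOf_eq]
    constructor
    · rintro ⟨hx, h0⟩; exact ⟨hx, (hzero x hx).1 h0⟩
    · rintro ⟨hx, h0⟩; exact ⟨hx, (hzero x hx).2 h0⟩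

/-- ★ **T2 — the coordinate-face lift**: A1 (the 0/1 points of the queue-grid face, as an explicit hypothesis: for
`r ≥ 1`, `n ≥ (r+1)(2r+1)` there are a finite coordinate set `Z` and an arc read-out `f` such that the support points of
`NN_n` vanishing on `Z`, read through `f`, are EXACTLY `range (patternVec r)`) and PP shadow hardness (`PPShadowHard`,
unfolded) give NFP shadow hardness (`NFPShadowHard`, unfolded): with `r + 1 = ⌊⌊√n⌋/2⌋` (so `(r+1)(2r+1) ≤ n` and
`log₂ n ≤ 2 log₂ r + 5`), a PP shadow with `> 2^((log₂ r + 3c+8)^(3c+8)) ≥ 4·2^((log₂ n + c)^c)` vertices has a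
coordinate pencil uniquely maximised at `> 2^((log₂ n + c)^c)` points, and the face lift `shadow_faceLift_count`
(HY21 Lemma 10, point form) along A1's located coordinate face realises them all as vertices of a shadow of
`suppPts NN_n`. [cite: HrubesYehudayoff2021, Lemma 10 / Prop 23 / Prop 43(2)] -/
theorem faceLift
    (hA : ∀ r n : ℕ, 1 ≤ r → (r + 1) * (2 * r + 1) ≤ n →
      ∃ (Z : Finset (Fin (2 * n) × Fin (2 * n)))
        (f : (QGV r × QGV r) × Bool × Bool → Fin (2 * n) × Fin (2 * n)),
        (fun x : (Fin (2 * n) × Fin (2 * n)) → ℝ => x ∘ f) ''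
            (suppPts (nestFreeMatchingPoly n ℝ≥0) ∩ {x | ∀ e ∈ Z, x e = 0}) = Set.range (patternVec r))
    (hP : ∀ c : ℕ, ∃ r₀ : ℕ, ∀ r ≥ r₀, ∃ Λ : (((QGV r × QGV r) × Bool × Bool) → ℝ) →ₗ[ℝ] (Fin 2 → ℝ),
      2 ^ ((Nat.log 2 r + c) ^ c) <
        (Set.extremePoints ℝ (convexHull ℝ (Λ '' Set.range (patternVec r)))).ncard) :
    ∀ c : ℕ, ∃ n₀ : ℕ, ∀ n ≥ n₀, ∃ L : ((Fin (2 * n) × Fin (2 * n)) → ℝ) →ₗ[ℝ] (Fin 2 → ℝ),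
      2 ^ ((Nat.log 2 n + c) ^ c) <
        (Set.extremePoints ℝ (convexHull ℝ (L '' suppPts (nestFreeMatchingPoly n ℝ≥0)))).ncard := by
  classical
  intro c
  obtain ⟨r₀, hr₀⟩ := hP (3 * c + 8)
  refine ⟨4 * (max (r₀ + 1) 3) ^ 2, fun n hn => ?_⟩
  set M := max (r₀ + 1) 3 with hM
  have hM3 : 3 ≤ M := le_max_right _ _
  have hMr : r₀ + 1 ≤ M := le_max_left _ _
  set s := Nat.sqrt n with hs
  have hsM : 2 * M ≤ s := by
    rw [hs, Nat.le_sqrt]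
    nlinarith [hn]
  set r := s / 2 - 1 with hr
  have hr2 : 2 ≤ r := by omega
  have hr1 : 1 ≤ r := by omega
  have hrr₀ : r₀ ≤ r := by omega
  have hr_s : r + 1 = s / 2 := by omega
  have hss : s * s ≤ n := Nat.sqrt_le n
  have hface : (r + 1) * (2 * r + 1) ≤ n := by
    have h2 : 2 * (s / 2) ≤ s := Nat.mul_div_le s 2
    calc (r + 1) * (2 * r + 1) ≤ (r + 1) * (2 * (r + 1)) := Nat.mul_le_mul_left _ (by omega)
      _ = (s / 2) * (2 * (s / 2)) := by rw [hr_s]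
      _ ≤ (s / 2) * s := Nat.mul_le_mul_left _ h2
      _ ≤ s * s := Nat.mul_le_mul_right _ (Nat.div_le_self s 2)
      _ ≤ n := hss
  obtain ⟨Z, f, hZf⟩ := hA r n hr1 hface
  obtain ⟨Λ, hΛ⟩ := hr₀ r hrr₀
  -- `log₂ n ≤ 2 log₂ r + 5`
  have hlogn : Nat.log 2 n < 2 * Nat.log 2 r + 6 := by
    have hA2 : r < 2 ^ (Nat.log 2 r + 1) := Nat.lt_pow_succ_log_self (by norm_num) r
    have hn_lt : n < (s + 1) * (s + 1) := Nat.lt_succ_sqrt n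
    have hs4 : s + 1 ≤ 4 * r := by omega
    have h16 : n < 16 * (r * r) := by
      calc n < (s + 1) * (s + 1) := hn_lt
        _ ≤ (4 * r) * (4 * r) := Nat.mul_le_mul hs4 hs4
        _ = 16 * (r * r) := by ring
    have hrr : r * r < 2 ^ (Nat.log 2 r + 1) * 2 ^ (Nat.log 2 r + 1) := Nat.mul_self_lt_mul_self hA2
    have hpow : n < 2 ^ (2 * Nat.log 2 r + 6) := by
      calc n < 16 * (r * r) := h16
        _ < 16 * (2 ^ (Nat.log 2 r + 1) * 2 ^ (Nat.log 2 r + 1)) := Nat.mul_lt_mul_of_pos_left hrr (by norm_num)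
        _ = 2 ^ (2 * Nat.log 2 r + 6) := by ring
    have hn0 : n ≠ 0 := by
      have h6 : 6 ≤ s := by omega
      have h36 : 36 ≤ s * s := Nat.mul_le_mul h6 h6
      omega
    exact Nat.log_lt_of_lt_pow hn0 hpow
  -- threshold: `4 · T c n ≤ T (3c+8) r < #vertices of the PP shadow`
  have hthr : 4 * 2 ^ ((Nat.log 2 n + c) ^ c) ≤ 2 ^ ((Nat.log 2 r + (3 * c + 8)) ^ (3 * c + 8)) := by
    have h := faceLift_threshold c (Nat.log 2 n) (Nat.log 2 r) (by omega)
    calc 4 * 2 ^ ((Nat.log 2 n + c) ^ c) = 2 ^ ((Nat.log 2 n + c) ^ c + 2) := by rw [pow_add]; ring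
      _ ≤ 2 ^ ((Nat.log 2 r + (3 * c + 8)) ^ (3 * c + 8)) := Nat.pow_le_pow_right (by norm_num) h
  have hΛ' : 4 * 2 ^ ((Nat.log 2 n + c) ^ c) <
      (Set.extremePoints ℝ (convexHull ℝ (Λ '' Set.range (patternVec r)))).ncard :=
    lt_of_le_of_lt hthr hΛ
  -- the lift along A1's located coordinate face
  have hSfin : (suppPts (nestFreeMatchingPoly n ℝ≥0)).Finite := (Finset.finite_toSet _).image _
  obtain ⟨hψS, hset⟩ := sumCoord_face (suppPts (nestFreeMatchingPoly n ℝ≥0)) (suppPts_coord_dichotomy _) Z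
  have hY : (LinearMap.funLeft ℝ ℝ f) ''
      (suppPts (nestFreeMatchingPoly n ℝ≥0) ∩
        {x | (∑ a ∈ Z, LinearMap.proj a : ((Fin (2 * n) × Fin (2 * n)) → ℝ) →ₗ[ℝ] ℝ) x = 0}) =
      Set.range (patternVec r) := by
    rw [hset]; exact hZf
  exact shadow_faceLift_count (suppPts (nestFreeMatchingPoly n ℝ≥0)) hSfin _ hψS (LinearMap.funLeft ℝ ℝ f)
    (Set.range (patternVec r)) hY Λ (2 ^ ((Nat.log 2 n + c) ^ c)) hΛ'

end GridCorShadow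

end Summit.ValiantsHypothesis.ValiantsHypothesis.Theorems.FifoMatching

end
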